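import Literature.Probability.LatticeModels.SahiThirdOrderCorrelation
import HarnessLib

/-!
# Sahi's fourth-order correlation functional `E₄` (events form) and the branching identities `E₄(·,·,·,Ω) = 2E₃`, `E₃(·,·,Ω) = E₂`

Topic `Literature/Probability/LatticeModels`; companion of `SahiThirdOrderCorrelation.lean` (which defines `sahiE3` and
proves the printed proved cases of `E₃ ≥ 0`).  This file only DEFINES the next member of Sahi's hierarchy for four
events and PROVES the structural identities printed in the sources; apart from the elementary nested-chain case
`sahiE4_nonneg_of_chain` below it asserts no inequality (Sahi's Conjecture 5 /
Lieb–Sahi Conjecture 1.1, `E_n ≥ 0` for positive monotone functions under an FKG measure, is OPEN for every `n ≥ 3`,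
even for product measures on `{0,1}^k`: [LiebSahi2021, arXiv p. 3] "remains a conjecture, even for `n = 3, 4, 5`").

Sources.  S. Sahi, *Higher correlation inequalities*, Combinatorica **28** (2008) 209–227 [Sahi2008; author's reprint,
corpus paper:url-5f6060b183b5, journal page numbers]: `E_n = Σ_{λ ⊢ n} c_λ E_λ`, `c_λ = (−1)^{l(λ)−1} Π_i (λ_i − 1)!`
(eqs. (4)–(7), p. 211); "**Theorem 6.** The functionals `E_n(f_1,…,f_n)` satisfy conditions 2 and 3 with `d_n = n − 2`"
(p. 214), where condition 2 is "`P_n(f_1,…f_{n−1},1) = d_n P_{n−1}(f_1,…f_{n−1})`" and condition 3 is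
"`P_n(1,…,1,1) = 0`" (Richards' desiderata, p. 214).  E. H. Lieb, S. Sahi, *On the extension of the FKG inequality to
`n` functions*, J. Math. Phys. **63** (2022) = arXiv:2107.09838 [LiebSahi2021], Definition 3.1 and the displayed formula
(arXiv p. 7): "`E_4(f^1,f^2,f^3,f^4) = 6E(f^1f^2f^3f^4) − 2[E(f^1)E(f^2f^3f^4) + E(f^2)E(f^1f^3f^4) + ⋯]
+ [E(f^1)E(f^2)E(f^3f^4) + E(f^1)E(f^3)E(f^2f^4) + ⋯] − [E(f^1f^2)E(f^3f^4) + E(f^1f^3)E(f^2f^4) + ⋯] − E(f^1)E(f^2)E(f^3)E(f^4)`",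
and the branching property (arXiv p. 3, = [Sahi2008, Thm 6]) "`E_n(f_1,…,f_{n−1},1) = (n−2)E_{n−1}(f_1,…,f_{n−1})`".
Here `f^i = 1_{A_i}` are indicators of events, `E(f^i f^j ⋯) = μ(A_i ∩ A_j ∩ ⋯)`.

Contents: `sahiE4` (definition, events form) · `sahiE4_def` · `sahiE4_comm₁₂` (symmetry) · **`sahiE4_univ`**
(`E₄(A,B,C,Ω) = 2·E₃(A,B,C)` for a probability measure — Theorem 6 with `d_4 = 2`) · `sahiE3_univ`
(`E₃(A,B,Ω) = μ(A∩B) − μ(A)μ(B) = E₂`, `d_3 = 1`) · `sahiE3_univ_univ_univ`, `sahiE4_univ_univ_univ_univ` (condition 3)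
· `sahiE4_empty` (an empty event kills `E₄`) · complementation identity `sahiE4_compl`
(`E₄(Aᶜ,Bᶜ,Cᶜ,Dᶜ) = E₄ − 2Σ_{triples} E₃ + 2Σ_{pairs} E₂`; the `E₃` analogue `sahiE3_compl` is in
`Literature/Probability/Percolation/SahiSunflowerSeparation.lean`) · a PROVED case: `sahiE4_eq_of_chain`, `sahiE4_eq_of_chain₄`,
`sahiE4_self`, **`sahiE4_nonneg_of_chain`** (`E₄ ≥ 0` when three of the four events are nested and the fourth is positively
correlated with the smallest).  Motivation (this programme): the "(4, FKG)" entry of the cell's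
MASTER-FAMILY table for crux stmt-CriticalPhenomena-4575 (E₄ of four group-separation events; census filed) — this file
gives that row a name; nothing is claimed about its sign in general.
-/

namespace Literature.Probability.LatticeModels

open MeasureTheory

/-- **Sahi's fourth-order functional for four events** under a measure `μ` (Lieb–Sahi's `E_4(f^1,…,f^4)` for indicators
`f^i = 1_{A_i}`; Sahi's `E_4 = 6E_(4) − 2E_(3,1) + E_(2,1,1) − E_(2,2) − E_(1,1,1,1)`):
`E₄(A,B,C,D) = 6μ(ABCD) − 2Σ μ(A_i)μ(A_jA_kA_l) + Σ_{i<j} μ(A_i)μ(A_j)μ(A_kA_l) − Σ μ(A_iA_j)μ(A_kA_l) − μ(A)μ(B)μ(C)μ(D)`.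
[cite: LiebSahi2021, Definition 3.1 and formula for E_4 (arXiv p. 7); Sahi2008, eqs. (4)–(7) (p. 211)] -/
def sahiE4 {Ω : Type*} [MeasurableSpace Ω] (μ : Measure Ω) (A B C D : Set Ω) : ℝ :=
  6 * μ.real (A ∩ B ∩ C ∩ D)
    - 2 * (μ.real A * μ.real (B ∩ C ∩ D) + μ.real B * μ.real (A ∩ C ∩ D) + μ.real C * μ.real (A ∩ B ∩ D) +
        μ.real D * μ.real (A ∩ B ∩ C))
    + (μ.real A * μ.real B * μ.real (C ∩ D) + μ.real A * μ.real C * μ.real (B ∩ D) + μ.real A * μ.real D * μ.real (B ∩ C) +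
        μ.real B * μ.real C * μ.real (A ∩ D) + μ.real B * μ.real D * μ.real (A ∩ C) + μ.real C * μ.real D * μ.real (A ∩ B))
    - (μ.real (A ∩ B) * μ.real (C ∩ D) + μ.real (A ∩ C) * μ.real (B ∩ D) + μ.real (A ∩ D) * μ.real (B ∩ C))
    - μ.real A * μ.real B * μ.real C * μ.real D

/-- Unfolding lemma for `sahiE4`. [cite: LiebSahi2021, formula for E_4 (arXiv p. 7)] -/
theorem sahiE4_def {Ω : Type*} [MeasurableSpace Ω] (μ : Measure Ω) (A B C D : Set Ω) :
    sahiE4 μ A B C D = 6 * μ.real (A ∩ B ∩ C ∩ D)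
      - 2 * (μ.real A * μ.real (B ∩ C ∩ D) + μ.real B * μ.real (A ∩ C ∩ D) + μ.real C * μ.real (A ∩ B ∩ D) +
          μ.real D * μ.real (A ∩ B ∩ C))
      + (μ.real A * μ.real B * μ.real (C ∩ D) + μ.real A * μ.real C * μ.real (B ∩ D) +
          μ.real A * μ.real D * μ.real (B ∩ C) + μ.real B * μ.real C * μ.real (A ∩ D) +
          μ.real B * μ.real D * μ.real (A ∩ C) + μ.real C * μ.real D * μ.real (A ∩ B))
      - (μ.real (A ∩ B) * μ.real (C ∩ D) + μ.real (A ∩ C) * μ.real (B ∩ D) + μ.real (A ∩ D) * μ.real (B ∩ C))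
      - μ.real A * μ.real B * μ.real C * μ.real D := rfl

/-- `E₄` is symmetric under exchanging its first two arguments (it is a symmetric functional: `E_σ` only depends on the
cycle partition). [cite: LiebSahi2021, §3.1 (arXiv p. 7)] -/
theorem sahiE4_comm₁₂ {Ω : Type*} [MeasurableSpace Ω] (μ : Measure Ω) (A B C D : Set Ω) :
    sahiE4 μ A B C D = sahiE4 μ B A C D := by
  unfold sahiE4
  rw [Set.inter_comm B A]
  ring

/-- **Branching, `n = 3` (`d_3 = 1`): `E₃(A,B,Ω) = μ(A∩B) − μ(A)μ(B) = E₂(A,B)`** for a probability measure.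
[cite: Sahi2008, Theorem 6 (p. 214); LiebSahi2021, eq. (1.4) (arXiv p. 3)] -/
theorem sahiE3_univ {Ω : Type*} [MeasurableSpace Ω] (μ : Measure Ω) [IsProbabilityMeasure μ] (A B : Set Ω) :
    sahiE3 μ A B Set.univ = μ.real (A ∩ B) - μ.real A * μ.real B := by
  rw [sahiE3_def]
  simp only [Set.inter_univ, probReal_univ]
  ring

/-- **Branching, `n = 4` (`d_4 = 2`): `E₄(A,B,C,Ω) = 2·E₃(A,B,C)`** for a probability measure — Sahi's Theorem 6 for
`n = 4` (so `E₄ ≥ 0` on all quadruples implies `E₃ ≥ 0` on all triples: the conjectures form a hierarchy).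
[cite: Sahi2008, Theorem 6 (p. 214); LiebSahi2021, eq. (1.4) (arXiv p. 3)] -/
theorem sahiE4_univ {Ω : Type*} [MeasurableSpace Ω] (μ : Measure Ω) [IsProbabilityMeasure μ] (A B C : Set Ω) :
    sahiE4 μ A B C Set.univ = 2 * sahiE3 μ A B C := by
  rw [sahiE4_def, sahiE3_def]
  simp only [Set.inter_univ, probReal_univ]
  ring

/-- Condition 3 of Richards' desiderata for `n = 3`: `E₃(Ω,Ω,Ω) = 0`. [cite: Sahi2008, Theorem 6 (p. 214)] -/
theorem sahiE3_univ_univ_univ {Ω : Type*} [MeasurableSpace Ω] (μ : Measure Ω) [IsProbabilityMeasure μ] :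
    sahiE3 μ (Set.univ : Set Ω) Set.univ Set.univ = 0 := by
  rw [sahiE3_univ]
  simp only [Set.inter_univ, probReal_univ]
  ring

/-- Condition 3 of Richards' desiderata for `n = 4`: `E₄(Ω,Ω,Ω,Ω) = 0`. [cite: Sahi2008, Theorem 6 (p. 214)] -/
theorem sahiE4_univ_univ_univ_univ {Ω : Type*} [MeasurableSpace Ω] (μ : Measure Ω) [IsProbabilityMeasure μ] :
    sahiE4 μ (Set.univ : Set Ω) Set.univ Set.univ Set.univ = 0 := by
  rw [sahiE4_univ, sahiE3_univ_univ_univ, mul_zero]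

/-- An empty event kills `E₄` (every term contains a factor `μ(∅ ∩ ⋯) = 0` or `μ(∅) = 0`). [folklore] -/
theorem sahiE4_empty {Ω : Type*} [MeasurableSpace Ω] (μ : Measure Ω) (A B C : Set Ω) :
    sahiE4 μ A B C ∅ = 0 := by
  rw [sahiE4_def]
  simp only [Set.inter_empty, measureReal_empty]
  ring

/-! ### Complementation: `E₄` of the complementary events

Replacing every indicator `f^i = 1_{A_i}` by `1 − f^i = 1_{A_iᶜ}` and expanding by multilinearity, the slots filled
with the constant `1` collapse by the branching identities (`E₄(f,g,h,1) = 2E₃(f,g,h)`, `E₄(f,g,1,1) = 2E₂(f,g)`,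
`E₄(f,1,1,1) = E₄(1,1,1,1) = 0`, and `E₃(f,g,1) = E₂(f,g)`, `E₃(f,1,1) = E₃(1,1,1) = 0`), giving
`E₃(Aᶜ,Bᶜ,Cᶜ) = Σ_{pairs} E₂ − E₃(A,B,C)` and `E₄(Aᶜ,Bᶜ,Cᶜ,Dᶜ) = E₄(A,B,C,D) − 2Σ_{triples} E₃ + 2Σ_{pairs} E₂`
(`E₂(X,Y) = μ(X∩Y) − μ(X)μ(Y)`).  In particular the "decreasing" and "increasing" instances of `E₃ ≥ 0` on a triple of
events and on the triple of complements are DIFFERENT inequalities whose sum is the Harris/FKG sum `Σ_{pairs} E₂`.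
The `E₃` identity is already the tree's `sahiE3_compl` (`SahiSunflowerSeparation.lean`); the `E₄` identity is proved
here by inclusion–exclusion for a probability measure and measurable events. -/

section Complement

variable {Ω : Type*} [MeasurableSpace Ω] (μ : Measure Ω) [IsProbabilityMeasure μ]

/-- Inclusion–exclusion for two sets (real-valued, finite measure). [folklore] -/
private theorem real_union₂ {X Y : Set Ω} (hY : MeasurableSet Y) :
    μ.real (X ∪ Y) = μ.real X + μ.real Y - μ.real (X ∩ Y) := by
  have h := measureReal_union_add_inter (μ := μ) (s := X) hY
  linarith

/-- Inclusion–exclusion for three sets. [folklore] -/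
private theorem real_union₃ {X Y Z : Set Ω} (hY : MeasurableSet Y) (hZ : MeasurableSet Z) :
    μ.real (X ∪ Y ∪ Z) = μ.real X + μ.real Y + μ.real Z - μ.real (X ∩ Y) - μ.real (X ∩ Z) - μ.real (Y ∩ Z) +
      μ.real (X ∩ Y ∩ Z) := by
  have hXZ : X ∩ Z ∩ (Y ∩ Z) = X ∩ Y ∩ Z := by
    ext ω; simp only [Set.mem_inter_iff]; tauto
  rw [real_union₂ μ hZ, real_union₂ μ hY, Set.union_inter_distrib_right, real_union₂ μ (hY.inter hZ), hXZ]
  ring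

/-- Inclusion–exclusion for four sets. [folklore] -/
private theorem real_union₄ {X Y Z W : Set Ω} (hY : MeasurableSet Y) (hZ : MeasurableSet Z)
    (hW : MeasurableSet W) :
    μ.real (X ∪ Y ∪ Z ∪ W) = μ.real X + μ.real Y + μ.real Z + μ.real W
      - μ.real (X ∩ Y) - μ.real (X ∩ Z) - μ.real (X ∩ W) - μ.real (Y ∩ Z) - μ.real (Y ∩ W) - μ.real (Z ∩ W)
      + μ.real (X ∩ Y ∩ Z) + μ.real (X ∩ Y ∩ W) + μ.real (X ∩ Z ∩ W) + μ.real (Y ∩ Z ∩ W)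
      - μ.real (X ∩ Y ∩ Z ∩ W) := by
  have h1 : X ∩ W ∩ (Y ∩ W) = X ∩ Y ∩ W := by
    ext ω; simp only [Set.mem_inter_iff]; tauto
  have h2 : X ∩ W ∩ (Z ∩ W) = X ∩ Z ∩ W := by
    ext ω; simp only [Set.mem_inter_iff]; tauto
  have h3 : Y ∩ W ∩ (Z ∩ W) = Y ∩ Z ∩ W := by
    ext ω; simp only [Set.mem_inter_iff]; tauto
  have h4 : X ∩ W ∩ (Y ∩ W) ∩ (Z ∩ W) = X ∩ Y ∩ Z ∩ W := by
    ext ω; simp only [Set.mem_inter_iff]; tauto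
  rw [real_union₂ μ hW, real_union₃ μ hY hZ, Set.union_inter_distrib_right, Set.union_inter_distrib_right,
    real_union₃ μ (hY.inter hW) (hZ.inter hW), h4, h1, h2, h3]
  ring

/-- `μ(Xᶜ ∩ Yᶜ)` by inclusion–exclusion (probability measure). [folklore] -/
private theorem real_compl₂ {X Y : Set Ω} (hX : MeasurableSet X) (hY : MeasurableSet Y) :
    μ.real (Xᶜ ∩ Yᶜ) = 1 - μ.real X - μ.real Y + μ.real (X ∩ Y) := by
  rw [← Set.compl_union, probReal_compl_eq_one_sub (hX.union hY), real_union₂ μ hY]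
  ring

/-- `μ(Xᶜ ∩ Yᶜ ∩ Zᶜ)` by inclusion–exclusion (probability measure). [folklore] -/
private theorem real_compl₃ {X Y Z : Set Ω} (hX : MeasurableSet X) (hY : MeasurableSet Y) (hZ : MeasurableSet Z) :
    μ.real (Xᶜ ∩ Yᶜ ∩ Zᶜ) = 1 - μ.real X - μ.real Y - μ.real Z + μ.real (X ∩ Y) + μ.real (X ∩ Z) + μ.real (Y ∩ Z) -
      μ.real (X ∩ Y ∩ Z) := by
  rw [← Set.compl_union, ← Set.compl_union, probReal_compl_eq_one_sub ((hX.union hY).union hZ),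
    real_union₃ μ hY hZ]
  ring

/-- `μ(Xᶜ ∩ Yᶜ ∩ Zᶜ ∩ Wᶜ)` by inclusion–exclusion (probability measure). [folklore] -/
private theorem real_compl₄ {X Y Z W : Set Ω} (hX : MeasurableSet X) (hY : MeasurableSet Y) (hZ : MeasurableSet Z)
    (hW : MeasurableSet W) :
    μ.real (Xᶜ ∩ Yᶜ ∩ Zᶜ ∩ Wᶜ) = 1 - μ.real X - μ.real Y - μ.real Z - μ.real W
      + μ.real (X ∩ Y) + μ.real (X ∩ Z) + μ.real (X ∩ W) + μ.real (Y ∩ Z) + μ.real (Y ∩ W) + μ.real (Z ∩ W)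
      - μ.real (X ∩ Y ∩ Z) - μ.real (X ∩ Y ∩ W) - μ.real (X ∩ Z ∩ W) - μ.real (Y ∩ Z ∩ W)
      + μ.real (X ∩ Y ∩ Z ∩ W) := by
  rw [← Set.compl_union, ← Set.compl_union, ← Set.compl_union,
    probReal_compl_eq_one_sub (((hX.union hY).union hZ).union hW), real_union₄ μ hY hZ hW]
  ring

/-- **Complementation identity for `E₄`:**
`E₄(Aᶜ,Bᶜ,Cᶜ,Dᶜ) = E₄(A,B,C,D) − 2[E₃(A,B,C) + E₃(A,B,D) + E₃(A,C,D) + E₃(B,C,D)] + 2Σ_{pairs} E₂`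
(multilinearity and the branching identities `E₄(f,g,h,1) = 2E₃(f,g,h)`, `E₄(f,g,1,1) = 2E₂(f,g)`,
`E₄(f,1,1,1) = E₄(1,1,1,1) = 0` of [Sahi2008, Theorem 6 (p. 214)]; proved by inclusion–exclusion). [folklore] -/
theorem sahiE4_compl {A B C D : Set Ω} (hA : MeasurableSet A) (hB : MeasurableSet B) (hC : MeasurableSet C)
    (hD : MeasurableSet D) :
    sahiE4 μ Aᶜ Bᶜ Cᶜ Dᶜ =
      sahiE4 μ A B C D - 2 * (sahiE3 μ A B C + sahiE3 μ A B D + sahiE3 μ A C D + sahiE3 μ B C D)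
        + 2 * ((μ.real (A ∩ B) - μ.real A * μ.real B) + (μ.real (A ∩ C) - μ.real A * μ.real C)
            + (μ.real (A ∩ D) - μ.real A * μ.real D) + (μ.real (B ∩ C) - μ.real B * μ.real C)
            + (μ.real (B ∩ D) - μ.real B * μ.real D) + (μ.real (C ∩ D) - μ.real C * μ.real D)) := by
  rw [sahiE4_def, sahiE4_def, sahiE3_def, sahiE3_def, sahiE3_def, sahiE3_def, real_compl₄ μ hA hB hC hD,
    real_compl₃ μ hB hC hD, real_compl₃ μ hA hC hD, real_compl₃ μ hA hB hD, real_compl₃ μ hA hB hC,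
    real_compl₂ μ hC hD, real_compl₂ μ hB hD, real_compl₂ μ hB hC, real_compl₂ μ hA hD, real_compl₂ μ hA hC,
    real_compl₂ μ hA hB, probReal_compl_eq_one_sub hA, probReal_compl_eq_one_sub hB, probReal_compl_eq_one_sub hC,
    probReal_compl_eq_one_sub hD]
  ring

end Complement

/-! ### A proved case: `E₄ ≥ 0` when three of the four events form a chain

If `A ⊆ B ⊆ C` then all intersections collapse to `A ∩ D, B ∩ D, C ∩ D` and the measures `a, b, c, d`, and
`E₄(A,B,C,D) = (2−b)(3−c)·(μ(A∩D) − a·d) + a(3−c)·(d − μ(B∩D)) + a(1−b)·(d − μ(C∩D))`, a sum of three nonnegative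
terms as soon as `b ≤ 1`, `c ≤ 1` and `A, D` are positively correlated (Harris / FKG / BHK for that one pair).  With
`D = Ω` this is `2·E₃(A,B,C) = 2a(1−b)(2−c)` (branching + Lieb–Sahi's chain formula [LiebSahi2021, Lemma 3.2
(arXiv p. 7)]); the four-event chain `A ⊆ B ⊆ C ⊆ D` gives `a(1−b)(2−c)(3−d)`.  So every `C₄` census row in which
three events are nested (or repeated) is a Harris-level theorem.  Not stated in print. -/

section Chain

variable {Ω : Type*} [MeasurableSpace Ω] (μ : Measure Ω)

/-- `E₄(A,B,C,D)` for a chain `A ⊆ B ⊆ C` (any measure), as a combination of the three "defects"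
`μ(A∩D) − ad`, `d − μ(B∩D)`, `d − μ(C∩D)`. [cite: LiebSahi2021, Definition 3.1 / formula for E_4 (arXiv p. 7)] -/
theorem sahiE4_eq_of_chain {A B C : Set Ω} (D : Set Ω) (hAB : A ⊆ B) (hBC : B ⊆ C) :
    sahiE4 μ A B C D =
      (2 - μ.real B) * (3 - μ.real C) * (μ.real (A ∩ D) - μ.real A * μ.real D) +
        μ.real A * (3 - μ.real C) * (μ.real D - μ.real (B ∩ D)) +
        μ.real A * (1 - μ.real B) * (μ.real D - μ.real (C ∩ D)) := by
  have hab : A ∩ B = A := Set.inter_eq_left.2 hAB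
  have hac : A ∩ C = A := Set.inter_eq_left.2 (hAB.trans hBC)
  have hbc : B ∩ C = B := Set.inter_eq_left.2 hBC
  rw [sahiE4_def]
  simp only [hab, hac, hbc]
  ring

/-- The four-event chain: `E₄(A,B,C,D) = a(1−b)(2−c)(3−d)` for `A ⊆ B ⊆ C ⊆ D` (any measure) — Lieb–Sahi's chain
formula at `n = 4`. [cite: LiebSahi2021, Lemma 3.2 (arXiv p. 7)] -/
theorem sahiE4_eq_of_chain₄ {A B C D : Set Ω} (hAB : A ⊆ B) (hBC : B ⊆ C) (hCD : C ⊆ D) :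
    sahiE4 μ A B C D = μ.real A * (1 - μ.real B) * (2 - μ.real C) * (3 - μ.real D) := by
  have had : A ∩ D = A := Set.inter_eq_left.2 ((hAB.trans hBC).trans hCD)
  have hbd : B ∩ D = B := Set.inter_eq_left.2 (hBC.trans hCD)
  have hcd : C ∩ D = C := Set.inter_eq_left.2 hCD
  rw [sahiE4_eq_of_chain μ D hAB hBC, had, hbd, hcd]
  ring

/-- The full diagonal: `E₄(A,A,A,A) = a(1−a)(2−a)(3−a)` (any measure). [cite: LiebSahi2021, Lemma 3.2 (arXiv p. 7)] -/
theorem sahiE4_self (A : Set Ω) :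
    sahiE4 μ A A A A = μ.real A * (1 - μ.real A) * (2 - μ.real A) * (3 - μ.real A) :=
  sahiE4_eq_of_chain₄ μ subset_rfl subset_rfl subset_rfl

/-- **`E₄ ≥ 0` when three of the four events form a chain.**  If `A ⊆ B ⊆ C`, `μ(B) ≤ 1`, `μ(C) ≤ 1` and `A, D` are
positively correlated (`μA·μD ≤ μ(A∩D)`), then `0 ≤ E₄(A,B,C,D)`.  (By the symmetry of `E₄` the chain may sit in
any three slots.)  Not stated in print. [cite: LiebSahi2021, Definition 3.1 (arXiv p. 7) and Lemma 3.2 (chains)] -/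
theorem sahiE4_nonneg_of_chain [IsFiniteMeasure μ] {A B C D : Set Ω} (hAB : A ⊆ B) (hBC : B ⊆ C)
    (hB : μ.real B ≤ 1) (hC : μ.real C ≤ 1) (hAD : μ.real A * μ.real D ≤ μ.real (A ∩ D)) :
    0 ≤ sahiE4 μ A B C D := by
  rw [sahiE4_eq_of_chain μ D hAB hBC]
  have hA0 : 0 ≤ μ.real A := measureReal_nonneg
  have hBD : μ.real (B ∩ D) ≤ μ.real D := measureReal_mono Set.inter_subset_right
  have hCD : μ.real (C ∩ D) ≤ μ.real D := measureReal_mono Set.inter_subset_right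
  refine add_nonneg (add_nonneg ?_ ?_) ?_
  · exact mul_nonneg (mul_nonneg (by linarith) (by linarith)) (sub_nonneg.2 hAD)
  · exact mul_nonneg (mul_nonneg hA0 (by linarith)) (sub_nonneg.2 hBD)
  · exact mul_nonneg (mul_nonneg hA0 (by linarith)) (sub_nonneg.2 hCD)

end Chain

end Literature.Probability.LatticeModels
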